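import Literature.NumberTheory.EllipticCurves.TianYuanZhang2017.GenusFieldFamily
import Literature.NumberTheory.EllipticCurves.IsogenyLocalPointsMaps
import Literature.NumberTheory.EllipticCurves.VariableChangePointsMap
import Mathlib.FieldTheory.Galois.Basic
import HarnessLib

/-!
# Tian–Yuan–Zhang 2017 §3 AS PRINTED: the genus-point descent data (`A`, `K_n`, `ℍ′_n`, `Z(d₀)`, `P(n)`, `τ`, `β′`)
# and the printed statements Prop. 3.4, Thm. 3.5 (main clause + both bullets), Lemma 3.18, Lemma 3.21 — DISPLAYS

**W2 PHASE 0 DRAFT (p2-lead L1-56, WAKE `HOME/b2b-bsdres-p2-lit-1/WAKE-W2-phase0.md`) — NOT PROPOSED TO THE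
GATE until the lead's W2 GO line.  Version v3 = v2 with the referee's PHASE 0 rulings applied
(`p2/REFEREE.md` l.317, p2-ref GEN 21, 2026-08-22T14:10Z, read at v2 sha16 f6d7036d0c646d39): (γ) F1 =
`thm35Main` FAITHFUL — PASS as a display (unchanged); (β) `thm35Bullet2Ie` KEEP as a display AND as a conjunct of
`Printed` (unchanged); (α) the former §6 'PROOF-INTERNAL DISPLAY' (`partTwoLineOdd/Even` and its four `bracket…`
sums, p0020 L119–L165) STRUCK — not a conjunct, not a separate fact at PHASE 0: the lines are derived in print by
one displayed operation ("apply `β′ + 1` to Prop. 3.4; by Lemma 3.21", p0020 L123–L124 / L149) from `prop34` +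
`lemma321` + `betaSpec` + `lemma318`, hence KERNEL WORK, and the even line's third bracket prints `∏_{i ≥ 1}`
(p0020 L162) where the derivation gives the product over all blocks — a letter/derivation discrepancy a numbered
statement would not carry.  Second read of record: p2-monsky-lit `p2/monsky/lit/w2/W2-SECONDREAD-1.md`
(27/27 CONFIRMED, NO OBJECTION; the two WLOG reductions `τ(½) := (2, 4)` and "`im` = either root of `−1`"
CONFIRMED; recommendation (4) applied to the docstring of `thm35Main`).  v2 = v0 + `[i]` = `cmI` as an ADDITIVE
automorphism via the tree's `VariableChange.pointEquiv`, `cmIPow k`, `betaPt` as additive maps — so the kernel may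
push `β′ + 1` and `[i]` through the sums of Prop. 3.4 without further display — + §1b, the `τ`-table ORDER FACTS
PROVED: `2τ(1) = 0 ≠ τ(1)`, `2τ(½) = τ(1)`, `[i]τ(1) = τ(1)`, `2[i]τ(½) = τ(1)`, `[i]²τ(½) = −τ(½)`,
`τ(½) − [i]τ(½) ∉ {0, τ(1)}`).**

HONEST FRAMING (cell `b2b-bsdres`, sub-lane «bsd-p2», literature seat `p2-lit-1`): this file DISPLAYS printed
statements of Y. Tian, X. Yuan, S.-W. Zhang, *Genus periods, genus points and congruent number problem*, Asian
J. Math. 21 (2017) 721–774 = arXiv:1411.4728 [TianYuanZhang2017], §3, as ONE named `Prop`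
(`tyz_genusPointData`, §5: "for every square-free `n ≡ 5, 6, 7 (mod 8)` there are data as in §3 satisfying
Prop. 3.4, Thm. 3.5, Lemma 3.18, Lemma 3.21 and the Galois facts of the proof of Thm. 3.5 (2)") over a
`structure GenusPointData n` (§2) whose fields are the paper's OBJECTS (the field `ℍ′_n`, `i`, `√−d`, `β′`,
the genus points `Z(d₀)`, the points `P(d)`, sign choices of `𝓛(d)`, the exponents of `ε(d₀, d₁) ∈ μ₄`) and
whose PREDICATES (§3–§4, one `def … : Prop` per printed statement, each with its chunk:line locator) are the
paper's STATEMENTS, VERBATIM — in particular Thm. 3.5's main clause is displayed WITH `ρ(n)` (the index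
`2^ρ = [E_n(ℚ) : φ_n(A_n(ℚ)) + E_n[2]]`, tree `rhoSubgroup n`) AND WITH `α_n` ("any point which generates the
free part of `A(K_n)⁻`"), exactly as printed (lead L1-56: the `ρ`-free reading is KERNEL WORK for
p2-monsky-lit, never a display).  Nothing is asserted (no `_holds`, D-0014); nothing here is the conjectural
strengthening "U⁺" (which is NOT in print and is displayed NOWHERE); no count moves.  The proof-internal lines of
the proof of Thm. 3.5 (2) (p0020 L119–L165) are NOT displayed (referee ruling (α), above): they are kernel work
from `prop34` + `lemma321` + `betaSpec` + `lemma318`.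

## Source, model, conventions (all locators = chunks of the materialised arXiv text `paper:arxiv-1411.4728`)

* §3 standing assumption: "`n ≡ 5, 6, 7 (mod 8)` throughout this section" (p0010 L3–L5); "we will mainly work
  on the elliptic curve `A : 2y² = x³ + x` (instead of `E : y² = x³ − x`), which is isomorphic to
  `(X₀(32), ∞)`" (p0010 L11); "Denote `K_n = ℚ(√−n)`" (p0010 L46).  MODEL: `A` is displayed as the
  `ℚ`-isomorphic short model `curveA : Y² = X³ + 4X` (`X = 2x`, `Y = 4y`: `Y² = 16y² = 8(x³ + x) = X³ + 4X`),
  which IS the tree's `(congruentNumberCurve 1).twoIsogenyCodomain` (`curveA_eq_twoIsogenyCodomain`); "any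
  `2`-isogeny from `A` to `E`" (Thm. 3.5) is displayed through the tree's explicit one,
  `curveA.twoIsogenyPointsHom H : A(H) → A₂(H)`, `A₂ : Y² = X³ − 16X = congruentNumberCurve 4 ≅_ℚ E`
  (kernel `{O, (0,0)} = {0, τ(1)}`, Lemma 3.16's "same kernel `{0, τ(1)}`", p0017 L105–L113).  `K_d = ℚ(√−d)`
  is the tree's `GenusField d = ℚ[X]/(X² + d)`; its conjugation is `genusFieldConj d`; "`A(K_n)⁻ := {α ∈ A(K_n) :
  ᾱ = −α}`" (p0011 L33) is `minusPart n`.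
* CM and `τ` (p0011 L121–L128, p0012 L1–L18; Lemma 3.16 p0017 L98–L101: "`A(ℚ(i)) = A[(1+i)³]`"): `[i]` acts
  on `curveA` by `(X, Y) ↦ (−X, iY)` (`cmI`); `τ : ℂ/(1+i)ℤ[i] → A(ℂ)` is `ℤ[i]`-linear, so on
  `½ℤ[i]/(1+i)ℤ[i] ≅ A[(1+i)³] = {O, (0,0), (±2i,0), (2,±4), (−2,±4i)}` it is determined by `t := τ(1/2)`:
  `τ(1) = 2t = (0,0)` (the kernel of `φ`), `τ(i/2) = [i]t`, `τ((1∓i)/2) = t ∓ [i]t`, and `τ(1/2) ∈ A(ℝ) ∩ A(ℚ(i))`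
  (p0011 L126: "`ℝ/2ℤ` maps onto `A(ℝ)`") is `(2, 4)` or `(2, −4)`.  The paper FIXES the identification
  `i₀ : (X₀(32), ∞) → A` (p0010 L12) and then `τ` by `τ(1/2) = [0]` (p0012 L10–L16) — a CHOICE; composing
  `i₀` with `[−1]` replaces `(f_n, z_n, Z, P, α_n)` by their negatives and `τ(1/2)` by `−τ(1/2)`, under which
  every displayed statement is invariant (Prop. 3.4 is a congruence mod `2A`; Thm. 3.5 allows `±α_n`;
  Lemma 3.21's cosets `g·τ(·) + ℤτ(1)` are symmetric, its `n ≡ 7` equality changes sign on both sides).  So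
  THIS FILE normalises `tauHalf := (2, 4)` WITHOUT LOSS (the existential over the data absorbs the sign) —
  CROSS-READERS: please confirm this reduction (rider of S1-type).  Likewise `im` is EITHER square root of
  `−1` in `ℍ′_n` (the cosets `[i]t + ℤτ(1)`, `t − [i]t + ℤτ(1)` and everything mod `2A` are invariant under
  `i ↦ −i`).
* `ε(d₀, d₁) ∈ μ₄` (Thm. 3.3, p0011 L49–L51: "`ε(d₀,d₁) = ±i` if `(d₀, d₁) ≡ (5, 3) (mod 8)` and `= ±1`
  otherwise"; "as in Theorem (GZ)", p0011 L72) is carried as an exponent `eps d₀ d₁ : ℕ`, `ε = i^{eps}`, with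
  the printed parity constraint (`eps_spec`); its SIGN is not printed (it is whatever makes Thm. 3.3 hold)
  and is part of the data.  `𝓛(d)` "is only well-defined up to a sign" (§1): a sign choice `scriptL d ∈ ℤ`
  with `IsScriptL d (scriptL d)` (Thm. 1.1 / 1.2 integrality, p0011 L73: "`𝓛(d₁) ∈ ℤ` by Theorem (lg)") is
  part of the data.
* The field `ℍ′_n := L_n(i) · ∏_{d₀ ∣ n, d₀ ≡ 5,6 (8)} H′_{d₀} ⊂ ℚ̄` (p0011 L60–L66; `L_n(i) = ℚ(i, √d : d ∣ n)`)
  is displayed as an abstract number field `H`, Galois over `ℚ` (rider R-c: USED by the paper when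
  restricting `β′ ∈ Gal(ℚ̄/ℚ)` to `A(ℍ′_n)`, p0020 L22/L117 "any liftings"; a compositum of Galois
  extensions), containing `i` and `√−d` for `d ∣ n` (hence `K_d ⊂ L_n(i) ⊂ ℍ′_n`, rider R-b), together with
  `β := β′|_H ∈ Aut(H/ℚ)` (well defined since `H/ℚ` is Galois).
* "(γ + 1)R means γ(R) + R" (p0020 L24, printed "γ(R)+1", an evident misprint).

## What the cross-readers should check per predicate (decl · locator · verbatim? · differences named)

`scriptL_spec` p0011 L73 + §1 · `eps_spec` p0011 L51 · `recursion` p0011 L67–L70 · `prop34` p0011 L76–L89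
(sum over NON-ORDERED decompositions with the printed side conditions; `ε` replaced by its TYPE `[i]`/`1`,
faithful modulo `2A(ℍ′_n)` since `−Q ≡ Q`; the `ℓ = 0` term `Z(n)` INCLUDED — the F-Σ2 lesson, p0016 L146)
· `thm35Main` p0011 L27–L36 + L94–L95 (WITH `ρ` and `α_n`; "equal in `A(ℍ′_n) ⊗ ℚ`" rendered as
"`2^{1+ρ} P(n) − 𝓛(n)·α_n` is torsion", up to the common sign `s = ±1` of `𝓛`/`α_n`; the `𝓛 = 0` clause
"`𝒫(n) = 0`" rendered as "`P(n)` torsion") · `thm35Bullet1` p0011 L98 · `thm35Bullet2` p0011 L100–L112 (= Thm. 1.2 with the point-form hypothesis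
`P(n) ∈ A(K_n)⁻ + A[4]`; sums = tree `genusSum₁`, `genusSum₂'`) · `thm35Bullet2Ie` p0011 L100 (the printed "i.e.":
point form ⟺ `2^{ρ+1} ∣ 𝓛(n)`; KEEP — referee ruling (β)) · `lemma318` p0017 L152–L153 (with
`A[(1+i)³] = {Q : 2Q ∈ {0, τ(1)}}`; the `n` even clause `A(ℍ′_n)_tor = A[4]` as "torsion ⇒ `4Q = 0`" AND
"`#A(ℍ′_n)[4] = 16`") · `betaSpec` p0020 L107–L122, L143–L148 (`β|K_n = (√−n ↦ −√−n)`, `β|ℚ(i) = id`,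
`(β+1)A[4] = A[2]` for `n` even — rider R-a: displayed as the set identity, NOT as "`β = κ`") · `lemma321`
p0020 L27–L45 (the package's single `β`: `β₁′` for `n ≡ 5, 7 (mod 8)` or `n ≡ −2 (mod 16)`, `β₂′` for
`n ≡ 6 (mod 16)`, p0020 L110–L114; the `d ≡ 6 (mod 8)` clause is displayed only for divisors `d ≡ n (mod 16)` —
every block `d₀ ≡ 6 (mod 8)` of a decomposition of `n` entering Prop. 3.4 / p0020 L153 has cofactor `≡ 1 (mod 8)`,
hence `d₀ ≡ n (mod 16)` — so the one `β` serves every `Z(d₀)` used, and for `d₀ ≡ 5, 7` the lemma is printed for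
both `βⱼ′`) · `scriptLSpec` for `1 < d ∣ n` only (`d = 1` never enters).

NOT displayed (not needed by the W2 deduction per `p2/idea-2/U-PLUS-TYPING-AID.md` §6, or not printed as a
statement): Thm. 3.3 (Gross–Zagier), Thm. 3.6 (Galois action on `z_n`), the CM points / `X_U` / `f_n`
(the data are abstract points), Lemma 3.16 first clause, Lemma 3.17 (its consequence for `β` is in `betaSpec`),
Lemmas 3.19–3.20, the `(u, v)`-model of `A_n`, and the proof-internal lines p0020 L119–L165 of the proof of
Thm. 3.5 (2) (referee ruling (α): kernel work).  No `_holds` is expected for the fact (CM theory of `X₀(32)`,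
Gross–Zagier / Yuan–Zhang–Zhang, class field theory).

References: [TianYuanZhang2017] §3 (chunks p0010–p0021 as cited inline); [Tian2014] Y. Tian, Camb. J. Math. 2
(2014), §2 (the curve `A`, `τ`); J. H. Silverman, AEC 2nd ed., III.4.5 (the explicit `2`-isogeny), X.4.9;
HOME/p2/idea-2/U-PLUS-TYPING-AID.md v0.2a §6–§7; HOME/p2/lit/U-PLUS-SECOND-READ-lit1.md;
HOME/p2/monsky/lit/w2/W2-SECONDREAD-1.md (second read of record); HOME/p2/REFEREE.md l.317 (rulings (α)(β)(γ));
HOME/p2/LEAD-OKS.md L1-53, L1-56, L1-61, L1-62, ML-49, ML-52, ML-53; unit `b2b-bsdres-p2-lit-1` GEN 8–9.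
-/

noncomputable section

open scoped Classical

open WeierstrassCurve Polynomial Finset

namespace Literature.NumberTheory.EllipticCurves.TianYuanZhang2017

/-! ## §1 The curve `A`, its CM by `i`, the torsion points `τ(1)`, `τ(1/2)`, the fields `K_d` inside a number field -/

/-- TYZ's curve `A : 2y² = x³ + x` (p0010 L11) in the `ℚ`-isomorphic short model `Y² = X³ + 4X`
(`X = 2x`, `Y = 4y`). [cite: TianYuanZhang2017, §3.1 (chunk p0010 L11)] -/
def curveA : WeierstrassCurve ℚ := ⟨0, 0, 0, 4, 0⟩

/-- `curveA` is the codomain `Y² = X³ + 4X` of the tree's explicit `2`-isogeny out of `E : y² = x³ − x =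
congruentNumberCurve 1` (so `A` and `E` are `2`-isogenous both ways, as in the paper).
[cite: TianYuanZhang2017, §3.1 (p0010 L11) and Lemma 3.16 (p0017 L105–L113)] -/
theorem curveA_eq_twoIsogenyCodomain : curveA = (congruentNumberCurve 1).twoIsogenyCodomain := by
  unfold curveA twoIsogenyCodomain congruentNumberCurve
  ext <;> norm_num

/-- `curveA = ⟨0, 0, 0, 4, 0⟩` is in the tree's two-torsion normal form `y² = x³ + ax² + bx` (instance plumbing for
the tree's explicit `2`-isogeny API `twoIsogenyPointsHom`). [folklore] -/
instance curveA_isTwoTorsionNF : curveA.IsTwoTorsionNF := by unfold curveA; infer_instance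

/-- `Δ(curveA) = −4096 = −2¹²`. [cite: TianYuanZhang2017, §3.1 (p0010 L11: A ≅ X₀(32))] -/
theorem curveA_Δ : curveA.Δ = -4096 := by
  unfold curveA
  simp [WeierstrassCurve.Δ, WeierstrassCurve.b₂, WeierstrassCurve.b₄, WeierstrassCurve.b₆, WeierstrassCurve.b₈]
  norm_num

/-- `curveA` is an elliptic curve (`Δ = −4096 ≠ 0`; instance plumbing). [folklore] -/
instance curveA_isElliptic : curveA.IsElliptic := ⟨by rw [curveA_Δ]; norm_num⟩

section OverField

variable (H : Type) [Field H] [CharZero H]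

/-- `A(H)`: the `H`-points of `curveA` for a field `H ⊇ ℚ`. [cite: TianYuanZhang2017, §3.1 (p0011 L66: "A(ℍ′_n) is a ℤ[i]-module")] -/
abbrev APoint : Type := (curveA.baseChange H).toAffine.Point

variable {H}

/-- The affine equation of `curveA` over `H`: `Y² = X³ + 4X`. [cite: TianYuanZhang2017, §3.1 (p0010 L11)] -/
theorem curveA_equation_iff (x y : H) :
    (curveA.baseChange H).toAffine.Equation x y ↔ y ^ 2 = x ^ 3 + 4 * x := by
  rw [WeierstrassCurve.Affine.equation_iff]
  simp [curveA, WeierstrassCurve.baseChange]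

/-- Every solution of `Y² = X³ + 4X` over a field of characteristic `0` is a nonsingular point (`Δ ≠ 0`).
[cite: TianYuanZhang2017, §3.1 (p0010 L11)] -/
theorem curveA_nonsingular_iff (x y : H) :
    (curveA.baseChange H).toAffine.Nonsingular x y ↔ y ^ 2 = x ^ 3 + 4 * x := by
  have hΔ : (curveA.baseChange H).Δ ≠ 0 := by
    rw [WeierstrassCurve.baseChange, WeierstrassCurve.map_Δ, curveA_Δ]; norm_num
  rw [← WeierstrassCurve.Affine.equation_iff_nonsingular_of_Δ_ne_zero hΔ, curveA_equation_iff]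

/-- `τ(1) = (0, 0)`: the generator of the kernel `{0, τ(1)}` of the `2`-isogeny `φ : A → E` (and of `[1+i]`).
[cite: TianYuanZhang2017, Lemma 3.16 (p0017 L105–L113); §3.2 (p0012 L16–L18)] -/
def tauOne : APoint H := .some (x := 0) (y := 0) ((curveA_nonsingular_iff 0 0).mpr (by ring))

/-- `τ(1/2) := (2, 4)`, a rational point of order `4` with `2·τ(1/2) = τ(1)`; the paper's normalisation
`τ(1/2) = [0]` (p0012 L10–L16) is `(2, 4)` or `(2, −4)` in these coordinates, and `(2, 4)` is taken WITHOUT LOSS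
(module docstring: the data `(Z, P, α_n)` absorb the sign). [cite: TianYuanZhang2017, §3.2 (p0011 L121–L128, p0012 L8–L18)] -/
def tauHalf : APoint H := .some (x := 2) (y := 4) ((curveA_nonsingular_iff 2 4).mpr (by norm_num))

/-- The change of variables `(X, Y) = (u²X′, u³Y′)` with `u = im` (`im² = −1`), i.e. `X′ = −X`, `Y′ = im·Y`;
it fixes the equation `Y² = X³ + 4X` (`u⁴ = 1`). [cite: TianYuanZhang2017, §3.1 (p0011 L66: "A(ℍ′_n) is a ℤ[i]-module")] -/
def cmIChange (im : H) (him : im ^ 2 = -1) : VariableChange H :=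
  ⟨Units.mk0 im (by rintro rfl; norm_num at him), 0, 0, 0⟩

/-- `cmIChange` is an automorphism of the equation of `A`. [cite: TianYuanZhang2017, §3.1 (p0011 L66)] -/
theorem cmIChange_smul (im : H) (him : im ^ 2 = -1) :
    cmIChange im him • curveA.baseChange H = curveA.baseChange H := by
  have h4 : im⁻¹ ^ 4 = 1 := by
    rw [inv_pow, show im ^ 4 = (im ^ 2) ^ 2 by ring, him]; norm_num
  ext
  · simp [cmIChange, curveA, WeierstrassCurve.baseChange, variableChange_a₁]
  · simp [cmIChange, curveA, WeierstrassCurve.baseChange, variableChange_a₂]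
  · simp [cmIChange, curveA, WeierstrassCurve.baseChange, variableChange_a₃]
  · simp [cmIChange, curveA, WeierstrassCurve.baseChange, variableChange_a₄, h4]
  · simp [cmIChange, curveA, WeierstrassCurve.baseChange, variableChange_a₆]

/-- **Complex multiplication by `i` on `A(H)`** for a field `H` containing a square root `im` of `−1`: the
ADDITIVE automorphism `[i](X, Y) = (−X, im·Y)` (`cmI_some`), built as the tree's points-isomorphism of the change
of variables `cmIChange` (Silverman AEC III.3.1(b)) — so that `A(H)` is a `ℤ[i]`-module and `τ` is
`ℤ[i]`-linear: `τ(i·z) = [i]τ(z)`. [cite: TianYuanZhang2017, §3.1 (p0011 L66) and §3.2 (p0011 L121–L125)] -/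
def cmI (im : H) (him : im ^ 2 = -1) : AddAut (APoint H) :=
  (VariableChange.pointEquiv (curveA.baseChange H) (cmIChange im him)).trans
    (WeierstrassCurve.Affine.Point.congrEquiv (cmIChange_smul im him))

/-- `[i](X, Y) = (−X, im·Y)` on affine points. [cite: TianYuanZhang2017, §3.1 (p0011 L66)] -/
theorem cmI_some (im : H) (him : im ^ 2 = -1) {x y : H} (h : (curveA.baseChange H).toAffine.Nonsingular x y) :
    cmI im him (.some x y h) = .some (-x) (im * y) (by
      rw [curveA_nonsingular_iff] at h ⊢
      rw [mul_pow, him, h]; ring) := by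
  have hinv : im⁻¹ = -im := inv_eq_of_mul_eq_one_right (by linear_combination -him)
  simp only [cmI, AddEquiv.trans_apply, VariableChange.pointEquiv_some,
    WeierstrassCurve.Affine.Point.congrEquiv_some]
  congr 1
  · simp only [VariableChange.toX_def, cmIChange, Units.val_inv_eq_inv_val, Units.val_mk0, hinv, sub_zero]
    linear_combination x * him
  · simp only [VariableChange.toY_def, cmIChange, Units.val_inv_eq_inv_val, Units.val_mk0, hinv,
      zero_mul, sub_zero]
    linear_combination (-im * y) * him

/-- `[i]^k : A(H) →+ A(H)`, the action of `i^k ∈ μ₄` (used for `ε(d₀, d₁) ∈ μ₄` and for `i^{(n−1)/2}`).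
[cite: TianYuanZhang2017, Thm. 3.3 (p0011 L49–L51: ε ∈ μ₄)] -/
def cmIPow (im : H) (him : im ^ 2 = -1) : ℕ → (APoint H →+ APoint H)
  | 0 => AddMonoidHom.id _
  | k + 1 => (cmI im him).toAddMonoidHom.comp (cmIPow im him k)

/-! ### §1b The `τ`-table ORDER FACTS on `curveA` (proved; the inputs LAYER A of the W2 kernel consumes):
`2τ(1) = 0 ≠ τ(1)`, `2τ(1/2) = τ(1)`, `[i]τ(1) = τ(1)`, `2·[i]τ(1/2) = τ(1)`, `2(τ(1/2) − [i]τ(1/2)) = 0`,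
`τ(1/2) − [i]τ(1/2) ∉ {0, τ(1)}`. -/

/-- The coefficients of `A` over `H`: `(a₁, a₂, a₃, a₄, a₆) = (0, 0, 0, 4, 0)`. [cite: TianYuanZhang2017, §3.1 (p0010 L11)] -/
theorem curveA_baseChange_a :
    (curveA.baseChange H).a₁ = 0 ∧ (curveA.baseChange H).a₂ = 0 ∧ (curveA.baseChange H).a₃ = 0 ∧
      (curveA.baseChange H).a₄ = 4 ∧ (curveA.baseChange H).a₆ = 0 := by
  simp [curveA, WeierstrassCurve.baseChange]

/-- `2τ(1) = 0`. [cite: TianYuanZhang2017, Lemma 3.16 (p0017 L105–L113: {0, τ(1)} = ker φ)] -/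
theorem two_nsmul_tauOne : (2 : ℕ) • (tauOne : APoint H) = 0 := by
  rw [two_nsmul, tauOne]
  exact WeierstrassCurve.Affine.Point.add_of_Y_eq rfl (by simp [WeierstrassCurve.Affine.negY])

/-- `τ(1) ≠ 0`. [cite: TianYuanZhang2017, Lemma 3.16 (p0017 L105–L113)] -/
theorem tauOne_ne_zero : (tauOne : APoint H) ≠ 0 := by
  rw [tauOne]; exact WeierstrassCurve.Affine.Point.some_ne_zero _

/-- `2τ(1/2) = τ(1)`: doubling `(2, 4)` on `Y² = X³ + 4X` gives `(0, 0)` (tangent slope `2`).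
[cite: TianYuanZhang2017, §3.2 (p0012 L12–L18: τ on ½ℤ[i]/(1+i)ℤ[i])] -/
theorem two_nsmul_tauHalf : (2 : ℕ) • (tauHalf : APoint H) = tauOne := by
  obtain ⟨h1, h2, h3, h4, -⟩ := curveA_baseChange_a (H := H)
  have hy : (4 : H) ≠ (curveA.baseChange H).toAffine.negY 2 4 := by
    rw [WeierstrassCurve.Affine.negY, h1, h3]; norm_num
  rw [two_nsmul, tauHalf, WeierstrassCurve.Affine.Point.add_self_of_Y_ne hy, tauOne]
  have hs : (curveA.baseChange H).toAffine.slope 2 2 4 4 = 2 := by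
    rw [WeierstrassCurve.Affine.slope_of_Y_ne rfl hy, WeierstrassCurve.Affine.negY, h1, h2, h3, h4]; norm_num
  simp only [WeierstrassCurve.Affine.Point.some.injEq]
  refine ⟨?_, ?_⟩
  · rw [WeierstrassCurve.Affine.addX, hs, h1, h2]; norm_num
  · rw [WeierstrassCurve.Affine.addY, WeierstrassCurve.Affine.negAddY, WeierstrassCurve.Affine.addX,
      WeierstrassCurve.Affine.negY, hs, h1, h2, h3]
    norm_num

/-- `[i]τ(1) = τ(1)` (`τ(i) = τ(1)`: `(0,0)` is fixed by `[i]`). [cite: TianYuanZhang2017, Lemma 3.16 (p0017 L105–L113: ker[1+i] = {0, τ(1)})] -/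
theorem cmI_tauOne (im : H) (him : im ^ 2 = -1) : cmI im him tauOne = tauOne := by
  rw [tauOne, cmI_some]
  simp only [neg_zero, mul_zero]

/-- `2·[i]τ(1/2) = τ(1)` (`[i]τ(1/2) = τ(i/2) = (−2, 4i)`). [cite: TianYuanZhang2017, §3.2 (p0012 L12–L18)] -/
theorem two_nsmul_cmI_tauHalf (im : H) (him : im ^ 2 = -1) :
    (2 : ℕ) • cmI im him (tauHalf : APoint H) = tauOne := by
  rw [← map_nsmul, two_nsmul_tauHalf, cmI_tauOne]

/-- `2·(τ(1/2) − [i]τ(1/2)) = 0` (`τ((1−i)/2) ∈ A[2]`). [cite: TianYuanZhang2017, §3.2 (p0012 L12–L18)] -/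
theorem two_nsmul_tauHalf_sub_cmI_tauHalf (im : H) (him : im ^ 2 = -1) :
    (2 : ℕ) • ((tauHalf : APoint H) - cmI im him tauHalf) = 0 := by
  rw [nsmul_sub, two_nsmul_tauHalf, two_nsmul_cmI_tauHalf, sub_self]

/-- `τ(1/2) − [i]τ(1/2) ≠ 0`. [cite: TianYuanZhang2017, §3.2 (p0012 L12–L18: τ is a bijection on ½ℤ[i]/(1+i)ℤ[i])] -/
theorem tauHalf_sub_cmI_tauHalf_ne_zero (im : H) (him : im ^ 2 = -1) :
    (tauHalf : APoint H) - cmI im him tauHalf ≠ 0 := by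
  rw [Ne, sub_eq_zero, tauHalf, cmI_some]
  simp only [WeierstrassCurve.Affine.Point.some.injEq, not_and]
  intro h; norm_num at h

/-- `[i][i]τ(1/2) = −τ(1/2)` (`[i]² = [−1]` on the `τ`-points, by coordinates). [cite: TianYuanZhang2017, §3.1 (p0011 L66)] -/
theorem cmI_cmI_tauHalf (im : H) (him : im ^ 2 = -1) :
    cmI im him (cmI im him (tauHalf : APoint H)) = -tauHalf := by
  rw [tauHalf, cmI_some, cmI_some, WeierstrassCurve.Affine.Point.neg_some]
  simp only [WeierstrassCurve.Affine.Point.some.injEq, neg_neg, WeierstrassCurve.Affine.negY,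
    (curveA_baseChange_a (H := H)).1, (curveA_baseChange_a (H := H)).2.2.1]
  refine ⟨trivial, ?_⟩
  linear_combination (4 : H) * him

/-- `τ(1/2) − [i]τ(1/2) ≠ τ(1)` (so `τ((1−i)/2) ∉ ℤτ(1) = {0, τ(1)}`). [cite: TianYuanZhang2017, §3.2 (p0012 L12–L18)] -/
theorem tauHalf_sub_cmI_tauHalf_ne_tauOne (im : H) (him : im ^ 2 = -1) :
    (tauHalf : APoint H) - cmI im him tauHalf ≠ tauOne := by
  intro h
  have h2 : cmI im him ((tauHalf : APoint H) - cmI im him tauHalf) = tauOne := by rw [h, cmI_tauOne]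
  rw [map_sub, cmI_cmI_tauHalf, sub_neg_eq_add] at h2
  have e : ((tauHalf : APoint H) - cmI im him tauHalf) + (cmI im him tauHalf + tauHalf) =
      tauHalf + tauHalf := by abel
  rw [h, h2, ← two_nsmul, ← two_nsmul, two_nsmul_tauOne, two_nsmul_tauHalf] at e
  exact tauOne_ne_zero e.symm

/-- The embedding `K_d = GenusField d = ℚ[X]/(X² + d) → H` sending the class of `X` to a chosen square root `x`
of `−d` in `H` (`d ≥ 1`; the defining polynomial is `X² + max(d, 1)`).
[cite: TianYuanZhang2017, §3.1 (p0011 L60–L64: K_n ⊂ L_n(i) ⊂ ℍ′_n)] -/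
def genusFieldEmb (d : ℕ) (x : H) (hx : x ^ 2 = -((max d 1 : ℕ) : H)) : GenusField d →ₐ[ℚ] H :=
  AdjoinRoot.liftAlgHom (genusFieldPoly d) (Algebra.ofId ℚ H) x (by
    rw [genusFieldPoly, Polynomial.eval₂_add, Polynomial.eval₂_pow, Polynomial.eval₂_X, Polynomial.eval₂_C, hx,
      map_natCast, neg_add_cancel])

end OverField

/-- In `K_d = ℚ[X]/(X² + max(d,1))` the class of `X` squares to `−max(d, 1)`. [cite: TianYuanZhang2017, §1 (p0002 L78–L82: K = ℚ(√−d))] -/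
theorem root_genusFieldPoly_sq (d : ℕ) :
    (AdjoinRoot.root (genusFieldPoly d)) ^ 2 = -((max d 1 : ℕ) : GenusField d) := by
  have h0 : AdjoinRoot.mk (genusFieldPoly d) (genusFieldPoly d) = 0 := AdjoinRoot.mk_self
  have h1 : AdjoinRoot.mk (genusFieldPoly d) (genusFieldPoly d) =
      (AdjoinRoot.root (genusFieldPoly d)) ^ 2 + ((max d 1 : ℕ) : GenusField d) := by
    conv_lhs => arg 2; rw [genusFieldPoly]
    rw [map_add, map_pow, AdjoinRoot.mk_X, AdjoinRoot.mk_C, map_natCast]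
  linear_combination h1.symm.trans h0

/-- The conjugation `√−d ↦ −√−d` of `K_d = GenusField d` (the `ᾱ` of "`A(K_n)⁻ := {α ∈ A(K_n) : ᾱ = −α}`").
[cite: TianYuanZhang2017, §3.1 (p0011 L33)] -/
def genusFieldConj (d : ℕ) : GenusField d →ₐ[ℚ] GenusField d :=
  genusFieldEmb d (-AdjoinRoot.root (genusFieldPoly d)) (by rw [neg_sq, root_genusFieldPoly_sq])

/-- `A(K_d)⁻ := {α ∈ A(K_d) : ᾱ = −α}` as a set of `K_d`-points of `curveA` (`K_d = GenusField d`).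
[cite: TianYuanZhang2017, §3.1 (p0011 L33)] -/
def minusPart (d : ℕ) : Set (APoint (GenusField d)) :=
  {α | WeierstrassCurve.Affine.Point.map (genusFieldConj d) α = -α}

/-- "`α_n ∈ A(K_n)⁻` is any point which generates the free part `A(K_n)⁻/A(K_n)⁻_tor`" (p0011 L36): `α` lies in
`A(K_n)⁻` and every element of `A(K_n)⁻` is an integer multiple of `α` up to torsion.  (The paper adds "if
`𝓛(n) ≠ 0`"; that the free part is then cyclic is PRESUPPOSED by the paper — Gross–Zagier–Kolyvagin — and is
here a HYPOTHESIS on `α`, per p2-lead ML-49: the display follows the page.)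
[cite: TianYuanZhang2017, §3.1 (p0011 L29–L36)] -/
def GeneratesFreePart (d : ℕ) (α : APoint (GenusField d)) : Prop :=
  α ∈ minusPart d ∧ ∀ γ ∈ minusPart d, ∃ m : ℤ, IsOfFinAddOrder (γ - m • α)

/-- `g(d) = #2Cl(ℚ(√−d))`, the genus class number, read in the tree's `GenusField d`.
[cite: TianYuanZhang2017, §1 (p0002 L78–L82)] -/
def gK (d : ℕ) : ℕ :=
  genusClassNumber (GenusField d)

/-- The index set of the RECURSION for `P(d)`: the divisors `d₀` of `d` with `d = d₀d₁`, `d₀ ≡ 5, 6, 7`,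
`d₁ ≡ 1, 2, 3 (mod 8)`, `d₁ > 1` (`d₁ = d/d₀`). [cite: TianYuanZhang2017, §3.1 (p0011 L67–L70)] -/
def recursionIndex (d : ℕ) : Finset ℕ :=
  d.divisors.filter fun d₀ => (d₀ % 8 = 5 ∨ d₀ % 8 = 6 ∨ d₀ % 8 = 7) ∧
    ((d / d₀) % 8 = 1 ∨ (d / d₀) % 8 = 2 ∨ (d / d₀) % 8 = 3) ∧ 1 < d / d₀

/-- The side condition of the FIRST sum of Prop. 3.4 / of Thm. 1.2's `Σ₂` for a block `d₀` of a decomposition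
`S`: `d₀ ≡ 5, 6, 7`, every other block `≡ 1, 2, 3 (mod 8)`, at most one of them `≢ 1 (mod 8)` (the `ℓ = 0`
decomposition `S = {n}` qualifies — "the contribution by `d₀ = n`, `d₁ = 1` is the single term `Z(n)`").
[cite: TianYuanZhang2017, Prop. 3.4 (p0011 L81–L84); proof (p0016 L146)] -/
def MainBlock (S : Finset ℕ) (d₀ : ℕ) : Prop :=
  (d₀ % 8 = 5 ∨ d₀ % 8 = 6 ∨ d₀ % 8 = 7) ∧ (∀ d ∈ S, d ≠ d₀ → (d % 8 = 1 ∨ d % 8 = 2 ∨ d % 8 = 3)) ∧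
    ((S.erase d₀).filter fun d => d % 8 ≠ 1).card ≤ 1

/-- The side condition of the SECOND sum of Prop. 3.4 for a block `d₀`: `(d₀, d₁, d₂) ≡ (5, 3, 2)`, all other
blocks `≡ 1 (mod 8)`. [cite: TianYuanZhang2017, Prop. 3.4 (p0011 L86–L88)] -/
def IBlock (S : Finset ℕ) (d₀ : ℕ) : Prop :=
  d₀ % 8 = 5 ∧ (∀ d ∈ S, d ≠ d₀ → (d % 8 = 1 ∨ d % 8 = 2 ∨ d % 8 = 3)) ∧
    ((S.erase d₀).filter fun d => d % 8 = 3).card = 1 ∧ ((S.erase d₀).filter fun d => d % 8 = 2).card = 1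

/-! ## §2 The data of §3.1: the field `ℍ′_n`, `i`, `√−d`, `β′`, the genus points `Z(d₀)`, the points `P(d)`, signs -/

/-- **The objects of Tian–Yuan–Zhang §3.1 for a given `n`** (nothing asserted about them here; §3–§4 are the
printed statements as predicates, §5 the one named fact).  Fields: `H` = the number field `ℍ′_n` (p0011 L62),
Galois over `ℚ` (used at p0020 L22 / L117); `im` = a square root of `−1` in `H` (`L_n(i) ⊂ ℍ′_n`); `sqrtNeg d` =
a square root of `−d` in `H` for `d ∣ n` (`K_d ⊂ L_n(i)`, p0011 L64, p0020 L58); `beta` = the restriction to `H`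
of a lifting `β′` of the paper's `β ∈ Gal(ℚ^ab/ℚ)` (p0020 L107–L117: `β = r_∞(−1)r₂(−2)` if `n ≡ 5, 7 (mod 8)` or
`n ≡ −2 (mod 16)`, `= r_∞(−1)r₂(6)` if `n ≡ 6 (mod 16)`); `Z d₀` = the genus point `Z(d₀) ∈ A(H′_{d₀}) ⊂ A(ℍ′_n)`
(p0011 L55–L58) for the divisors `d₀ ≡ 5, 6, 7 (mod 8)` of `n` (unused elsewhere); `P d` = the point `P(d)`
(p0011 L67–L70); `scriptL d` = a sign choice of `𝓛(d)` (§1, "defined up to sign"); `eps d₀ d₁` = an exponent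
with `ε(d₀, d₁) = i^{eps d₀ d₁}` (p0011 L51, L72).
[cite: TianYuanZhang2017, §3.1 (chunk p0011 L1–L73) and proof of Thm. 3.5 (2) (p0020 L107–L117)] -/
structure GenusPointData (n : ℕ) : Type 1 where
  /-- the number field `ℍ′_n` -/
  H : Type
  [instField : Field H]
  [instNumberField : NumberField H]
  [instIsGalois : IsGalois ℚ H]
  /-- `i ∈ ℍ′_n` -/
  im : H
  im_sq : im ^ 2 = -1
  /-- `√−d ∈ ℍ′_n` for `d ∣ n` -/
  sqrtNeg : ℕ → H
  sqrtNeg_sq : ∀ d ∈ n.divisors, sqrtNeg d ^ 2 = -((d : ℕ) : H)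
  /-- `β′|_{ℍ′_n}` -/
  beta : H ≃ₐ[ℚ] H
  /-- the genus points `Z(d₀)` -/
  Z : ℕ → APoint H
  /-- the points `P(d)` -/
  P : ℕ → APoint H
  /-- sign choices of `𝓛(d)`, `d ∣ n` -/
  scriptL : ℕ → ℤ
  /-- `ε(d₀, d₁) = i ^ eps d₀ d₁` -/
  eps : ℕ → ℕ → ℕ

attribute [instance] GenusPointData.instField GenusPointData.instNumberField GenusPointData.instIsGalois

namespace GenusPointData

variable {n : ℕ}

/-- `K_d ⊂ ℍ′_n` for `d ∣ n`: the embedding determined by `√−d ↦ D.sqrtNeg d`.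
[cite: TianYuanZhang2017, §3.1 (p0011 L60–L64)] -/
def embK (D : GenusPointData n) (d : ℕ) (hd : d ∈ n.divisors) : GenusField d →ₐ[ℚ] D.H :=
  genusFieldEmb d (D.sqrtNeg d) (by
    rw [max_eq_left (Nat.pos_of_mem_divisors hd)]
    exact D.sqrtNeg_sq d hd)

/-- `β′` acting on `A(ℍ′_n)` (the paper's `R ↦ R^{β′}`), the standard action `Affine.Point.map` of
`β ∈ Aut(H/ℚ)` on the `H`-points of the `ℚ`-curve `A` (an additive map).
[cite: TianYuanZhang2017, proof of Thm. 3.5 (2) (p0020 L22–L24, L117–L118)] -/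
def betaPt (D : GenusPointData n) : APoint D.H →+ APoint D.H :=
  WeierstrassCurve.Affine.Point.map D.beta.toAlgHom

/-- `[i]` on `A(ℍ′_n)` (additive automorphism). [cite: TianYuanZhang2017, §3.1 (p0011 L66)] -/
def iPt (D : GenusPointData n) : AddAut (APoint D.H) :=
  cmI D.im D.im_sq

/-- `τ(i/2) = [i]τ(1/2)`. [cite: TianYuanZhang2017, §3.2 (p0012 L16–L18) and Lemma 3.21 (p0020 L36, L41)] -/
def tauIHalf (D : GenusPointData n) : APoint D.H :=
  D.iPt tauHalf

/-- `τ((1−i)/2) = τ(1/2) − [i]τ(1/2)`. [cite: TianYuanZhang2017, §3.2 (p0012 L16–L18) and Lemma 3.21 (p0020 L31)] -/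
def tauHalfOneMinusI (D : GenusPointData n) : APoint D.H :=
  tauHalf - D.iPt tauHalf

/-! ## §3 The printed statements as predicates on the data: signs, recursion, Prop. 3.4, Thm. 3.5 -/

/-- **`𝓛(d) ∈ ℤ` for `1 < d ∣ n`, with the data's sign choice**: `IsScriptL d (D.scriptL d)` (`(scriptL d)² =
𝓛(d)²`).  (Thm. 1.1 for `d ≡ 1, 2, 3`, Thm. 1.2 / Thm. 3.5 first bullet for `d ≡ 5, 6, 7 (mod 8)`; "Note that
`𝓛(d₁) ∈ ℤ` by Theorem (lg)", p0011 L73; only `d₁ > 1` enters the recursion, so `d = 1` is not constrained.)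
[cite: TianYuanZhang2017, §3.1 (p0011 L73) and Thms. 1.1, 1.2] -/
def scriptLSpec (D : GenusPointData n) : Prop :=
  ∀ d ∈ n.divisors, 1 < d → IsScriptL d (D.scriptL d)

/-- **`ε(d₀, d₁) = ±i` if `(d₀, d₁) ≡ (5, 3) (mod 8)` and `±1` otherwise** (its sign is not printed): the exponent
`eps d₀ d₁` is odd iff `(d₀, d₁) ≡ (5, 3) (mod 8)`. [cite: TianYuanZhang2017, Thm. 3.3 (p0011 L49–L51)] -/
def epsSpec (D : GenusPointData n) : Prop :=
  ∀ d₀ d₁ : ℕ, D.eps d₀ d₁ % 2 = 1 ↔ (d₀ % 8 = 5 ∧ d₁ % 8 = 3)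

/-- **The recursion** "`P(n) := Z(n) − Σ_{n = d₀d₁, d₀ ≡ 5,6,7, d₁ ≡ 1,2,3 (mod 8), d₁ > 1} ε(d₀, d₁)𝓛(d₁)P(d₀)`",
displayed for every divisor `d ≡ 5, 6, 7 (mod 8)` of `n` ("Define `P(n) ∈ A(ℍ′_n)` inductively").
[cite: TianYuanZhang2017, §3.1 (chunk p0011 L67–L73)] -/
def recursion (D : GenusPointData n) : Prop :=
  ∀ d ∈ n.divisors, (d % 8 = 5 ∨ d % 8 = 6 ∨ d % 8 = 7) →
    D.P d = D.Z d - ∑ d₀ ∈ recursionIndex d,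
      cmIPow D.im D.im_sq (D.eps d₀ (d / d₀)) (D.scriptL (d / d₀) • D.P d₀)

/-- The FIRST sum of Prop. 3.4 as a point of `A(ℍ′_n)`:
`Σ_{n = d₀d₁⋯d_ℓ, d₀ ≡ 5,6,7, d₁ ≡ 1,2,3, dᵢ ≡ 1 (i > 1)} ε(d₀,d₁)(∏_{i ≥ 1} g(dᵢ)) Z(d₀)` with `ε` replaced by its
TYPE — `[i]` iff `(d₀, d₁) ≡ (5, 3)`, else `1` (faithful modulo `2A(ℍ′_n)`, the modulus of Prop. 3.4) — over the
tree's NON-ORDERED `decompositions n`. [cite: TianYuanZhang2017, Prop. 3.4 (chunk p0011 L76–L89)] -/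
def prop34SumMain (D : GenusPointData n) : APoint D.H :=
  ∑ S ∈ decompositions n, ∑ d₀ ∈ S.filter (fun d₀ => MainBlock S d₀),
    (∏ d ∈ S.erase d₀, gK d) •
      (if d₀ % 8 = 5 ∧ ∃ d ∈ S, d % 8 = 3 then D.iPt (D.Z d₀) else D.Z d₀)

/-- The SECOND sum of Prop. 3.4, `i·Σ_{(d₀,d₁,d₂) ≡ (5,3,2), dᵢ ≡ 1 (i > 2)} (∏_{i ≥ 1} g(dᵢ)) Z(d₀)`, as a point
(with the factor `i` applied). [cite: TianYuanZhang2017, Prop. 3.4 (chunk p0011 L86–L89)] -/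
def prop34SumI (D : GenusPointData n) : APoint D.H :=
  ∑ S ∈ decompositions n, ∑ d₀ ∈ S.filter (fun d₀ => IBlock S d₀),
    (∏ d ∈ S.erase d₀, gK d) • D.iPt (D.Z d₀)

/-- **Proposition 3.4** (verbatim in the module docstring): in `A(ℍ′_n)`,
`P(n) ≡ Σ_main ε(d₀,d₁)(∏_{i≥1} g(dᵢ)) Z(d₀) + i Σ_{(5,3,2)} (∏_{i≥1} g(dᵢ)) Z(d₀) (mod 2A(ℍ′_n))`.
[cite: TianYuanZhang2017, Prop. 3.4 (chunk p0011 L76–L89)] -/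
def prop34 (D : GenusPointData n) : Prop :=
  ∃ Q : APoint D.H, D.P n - D.prop34SumMain - D.prop34SumI = (2 : ℕ) • Q

/-- **Theorem 3.5, main clause, AS PRINTED — with `ρ(n)` and `α_n`.**  "`𝒫(n) := 2^{−1−ρ(n)}𝓛(n)α_n ∈
A(K_n)⁻ ⊗_ℤ ℚ`, where … `α_n ∈ A(K_n)⁻` is any point which generates the free part `A(K_n)⁻/A(K_n)⁻_tor` if
`𝓛(n) ≠ 0`. Note that `𝒫(n) = 0` if `𝓛(n) = 0`." (p0011 L27–L36); "`2^{ρ(n)} = [E_n(ℚ) : φ_n(A_n(ℚ)) + E_n[2]]`"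
(p0002 L101–L103, the tree's `(rhoSubgroup n).index`); "The vector `𝒫(n) ∈ A(K_n)⁻ ⊗_ℤ ℚ` is represented by the
point `P(n) ∈ A(ℍ′_n)` in the sense that they are equal in `A(ℍ′_n) ⊗_ℤ ℚ`" (p0011 L94–L95).  Rendering: for
every `ρ` with `index = 2^ρ`: if `𝓛(n) = 0` then `P(n)` is torsion; if `𝓛(n) ≠ 0` then for every `α` generating
the free part of `A(K_n)⁻`, `2^{1+ρ}·P(n) − s·𝓛(n)·α` is torsion in `A(ℍ′_n)` for a sign `s = ±1`.  EXPLICIT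
(second read ML-52 (4), referee (γ)): the sign `s` (which may depend on `α`) absorbs BOTH printed sign
conventions — "`𝓛(n)` is only well-defined up to a sign" (§1, p0002 L79) and `α_n` "any" generator (so `±α_n`) —
and `D.scriptL n` occurs in no other conjunct except `thm35Bullet2Ie` (sign-free), so no hidden sign coupling;
and `GeneratesFreePart n α` CARRIES the print's silent rank-one PRESUPPOSITION (that the free part
`A(K_n)⁻/A(K_n)⁻_tor` is cyclic when `𝓛(n) ≠ 0` — Gross–Zagier–Kolyvagin, not asserted in print at p0011 L36,
only presupposed) as a HYPOTHESIS on `α`: if no such generator exists the clause is vacuous (a weakening, never a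
strengthening), and the W2 deduction supplies the generator from its own `hGZK`.  The `ρ`-FREE reading is NOT
displayed (kernel work).
[cite: TianYuanZhang2017, Thm. 3.5 (chunk p0011 L94–L95) with §3.1 (p0011 L27–L36) and §1 (p0002 L101–L110)] -/
def thm35Main (D : GenusPointData n) : Prop :=
  ∀ (hn : n ∈ n.divisors) (ρ : ℕ), (rhoSubgroup n).index = 2 ^ ρ →
    (D.scriptL n = 0 → IsOfFinAddOrder (D.P n)) ∧
    (D.scriptL n ≠ 0 → ∀ α : APoint (GenusField n), GeneratesFreePart n α →
      ∃ s : ℤ, (s = 1 ∨ s = -1) ∧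
        IsOfFinAddOrder (((2 : ℤ) ^ (ρ + 1)) • D.P n -
          (s * D.scriptL n) • WeierstrassCurve.Affine.Point.map (D.embK n hn) α))

/-- **Theorem 3.5, first bullet**: "The image of `2P(n)` under any `2`-isogeny from `A` to `E` belongs to
`E(K_n)⁻`, i.e. `𝓛(n)` is integral" — displayed for the tree's explicit `2`-isogeny `φ : A → A₂ = (Y² = X³ − 16X)`
(`curveA.twoIsogenyPointsHom`): `φ(2P(n))` is the image of a point of `A₂(K_n)⁻`.
[cite: TianYuanZhang2017, Thm. 3.5 first bullet (chunk p0011 L98); proof part (1) (p0019 L42–L51)] -/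
def thm35Bullet1 (D : GenusPointData n) : Prop :=
  ∀ (hn : n ∈ n.divisors), ∃ γ : (curveA.twoIsogenyCodomain.baseChange (GenusField n)).toAffine.Point,
    WeierstrassCurve.Affine.Point.map (genusFieldConj n) γ = -γ ∧
    curveA.twoIsogenyPointsHom D.H ((2 : ℕ) • D.P n) = WeierstrassCurve.Affine.Point.map (D.embK n hn) γ

/-- "`P(n) ∈ A(K_n)⁻ + A[4]`" — the hypothesis of Thm. 3.5's second bullet and of the proof of part (2)
("Assume that `P(n) = P + t` for some `P ∈ A(K_n)⁻` and `t ∈ A[4]`", p0020 L107), with `A(K_n)⁻ ⊂ A(ℍ′_n)` via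
`K_n ⊂ ℍ′_n`. [cite: TianYuanZhang2017, Thm. 3.5 second bullet (chunk p0011 L100); proof of Thm. 3.5 (2) (p0020 L107)] -/
def InMinusPlusFourTorsion (D : GenusPointData n) (hn : n ∈ n.divisors) : Prop :=
  ∃ α : APoint (GenusField n), α ∈ minusPart n ∧ ∃ t : APoint D.H, (4 : ℕ) • t = 0 ∧
    D.P n = WeierstrassCurve.Affine.Point.map (D.embK n hn) α + t

/-- **Theorem 3.5, second bullet** (= Thm. 1.2's parity conclusions with the hypothesis in point form):
"Assume that `P(n) ∈ A(K_n)⁻ + A[4]` … If `n ≡ 5, 7 (mod 8)`, then `Σ_{dᵢ ≡ 1 (i > 0)} ∏ᵢ g(dᵢ) ≡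
Σ_{d₀ ≡ 5,6,7; d₁ ≡ 1,2,3; dᵢ ≡ 1 (i > 1)} ∏ᵢ g(dᵢ) ≡ 0 (mod 2)`.  If `n ≡ 6 (mod 8)`, then `Σ_{d₀ ≡ 5,6,7; d₁ ≡ 1,2,3;
dᵢ ≡ 1 (i > 1)} ∏ᵢ g(dᵢ) ≡ 0 (mod 2)`" — the sums are the tree's `genusSum₁ n gK` and `genusSum₂' n gK` (WITH
the `ℓ = 0` term, ERRATUM F-Σ2). [cite: TianYuanZhang2017, Thm. 3.5 second bullet (chunk p0011 L100–L112)] -/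
def thm35Bullet2 (D : GenusPointData n) : Prop :=
  ∀ (hn : n ∈ n.divisors), D.InMinusPlusFourTorsion hn →
    ((n % 8 = 5 ∨ n % 8 = 7) → Even (genusSum₁ n gK) ∧ Even (genusSum₂' n gK)) ∧
    (n % 8 = 6 → Even (genusSum₂' n gK))

/-- **The printed "i.e." of Thm. 3.5's second bullet**: "Assume that `P(n) ∈ A(K_n)⁻ + A[4]`, i.e.
`2^{−ρ(n)}𝓛(n)` is even" — displayed as the asserted equivalence of the point-form hypothesis with
"`2^{ρ+1} ∣ 𝓛(n)`" for the `ρ` with `[E_n(ℚ) : φ_n(A_n(ℚ)) + E_n[2]] = 2^ρ`.  (An "i.e." INSIDE the printed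
statement of the theorem, hence typed as printed — referee ruling (β), `p2/REFEREE.md` l.317: KEEP as a display and as
a conjunct of `Printed`; it follows in print from the main clause, Lemma 3.18 and the rank-one presupposition,
and no W2 consumer uses it.) [cite: TianYuanZhang2017, Thm. 3.5 second bullet (chunk p0011 L100)] -/
def thm35Bullet2Ie (D : GenusPointData n) : Prop :=
  ∀ (hn : n ∈ n.divisors) (ρ : ℕ), (rhoSubgroup n).index = 2 ^ ρ →
    (D.InMinusPlusFourTorsion hn ↔ (2 : ℤ) ^ (ρ + 1) ∣ D.scriptL n)

/-! ## §4 The printed statements as predicates on the data: Lemma 3.18, the Galois facts on `β′`, Lemma 3.21 -/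

/-- **Lemma 3.18**: "The torsion subgroup `A(ℍ′_n)_tor = A[(1+i)³]` if `n` is odd, and `A(ℍ′_n)_tor = A[4]` if `n` is
even" — with `A[(1+i)³] = {Q : 2Q ∈ {0, τ(1)}}` (`= A(ℚ(i))`, Lemma 3.16), and for `n` even "`= A[4]`" rendered as
"every torsion point is killed by `4`" together with "`A(ℍ′_n)` has `16` points killed by `4`" (all of `A[4]` is
rational over `ℍ′_n`).  PRECISION (cross-read P2): for `n` odd the display is the inclusion `A(ℍ′_n)_tor ⊆
A[(1+i)³]` of the printed equality; the converse inclusion is the `8` explicit `ℚ(i)`-points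
`{O, (0,0), (±2i,0), (2,±4), (−2,±4i)}` (kernel-computable, not displayed).
[cite: TianYuanZhang2017, Lemma 3.18 (chunk p0017 L152–L153); Lemma 3.16 (p0017 L98–L101)] -/
def lemma318 (D : GenusPointData n) : Prop :=
  (Odd n → ∀ Q : APoint D.H, IsOfFinAddOrder Q →
      (2 : ℕ) • ((2 : ℕ) • Q) = 0 ∧ ((2 : ℕ) • Q = 0 ∨ (2 : ℕ) • Q = tauOne)) ∧
  (Even n → (∀ Q : APoint D.H, IsOfFinAddOrder Q → (4 : ℕ) • Q = 0) ∧
      Nat.card {Q : APoint D.H // (4 : ℕ) • Q = 0} = 16)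

/-- **The Galois facts on `β` used in the proof of Thm. 3.5 (2)**: "Explicit calculation shows that `β` acts on
`K_n` by `√−n ↦ −√−n`" (p0020 L118, before the case split: all three classes); "Note that `β` acts on `ℚ(i)`
trivially" (p0020 L121 — printed in the `n ≡ 5, 7` paragraph for the package `β = β₁′`, hence also for
`n ≡ −2 (mod 16)`; for `n ≡ 6 (mod 16)`, `β = β₂′`, it is implicit in p0020 L146–L148's appeal to Lemma 3.17, whose
`κ : ζ₈ ↦ ζ₈⁵` fixes `i`).  RESOLVED (cross-read P1, idea-2 `W2-CROSSREAD-1.md` §3; second read ML-52 row 20;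
referee l.317 by reciprocity on `ℚ(i)`: `r_∞(−1)` and `r₂(3)` act as `i ↦ −i`, `r₂(2)` trivially): `β(i) = i` for
BOTH packages; `β|ℚ(ζ₈) = κ` for `n ≡ 6 (mod 16)` (Lemma 3.17 applies), `= id` for `n ≡ 5, 7 (mod 8)` and
`n ≡ −2 (mod 16)` (then `(β+1)A[4] = 2A[4] = A[2]`); the identity `(β+1)(iQ) = i(β+1)Q` is what the kernel uses at
p0020 L160–L163.  And, for `n` even, "`P(n)^β + P(n) ∈ (β+1)A[4] = A[2]` by Lemma 3.17" (p0020 L146–L148) — the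
SET identity `(β+1)A[4] = A[2]` in `A(ℍ′_n) ⊇ A[4]` (rider R-a: NOT displayed as "`β = κ` on `ℚ(ζ₈)`", which would
be false for `n ≡ −2 (mod 16)`; the set identity is true in both sub-cases).
[cite: TianYuanZhang2017, proof of Thm. 3.5 (2) (chunk p0020 L107–L122, L143–L148); Lemma 3.17 (p0017 L136–L149)] -/
def betaSpec (D : GenusPointData n) : Prop :=
  (n ∈ n.divisors → D.beta (D.sqrtNeg n) = -D.sqrtNeg n) ∧
  D.beta D.im = D.im ∧
  (Even n →
    (∀ Q : APoint D.H, (4 : ℕ) • Q = 0 → (2 : ℕ) • (D.betaPt Q + Q) = 0) ∧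
    (∀ T : APoint D.H, (2 : ℕ) • T = 0 → ∃ Q : APoint D.H, (4 : ℕ) • Q = 0 ∧ D.betaPt Q + Q = T))

/-- **Lemma 3.21** (verbatim in the module docstring), for the genus points `Z(d₀)` of the divisors `d₀` of `n`
and the package's `β` (`= β₁′` if `n ≡ 5, 7 (mod 8)` or `n ≡ −2 (mod 16)`, `= β₂′` if `n ≡ 6 (mod 16)`, p0020
L110–L114): "For any `n ≡ 5 (mod 8)`, `Z(n)^{β₁′+1} = Z(n)^{β₂′+1} ∈ g(n)τ((1−i)/2) + ℤτ(1)`" (so for EITHER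
package `β`); "for any `n ≡ −2 (mod 16)`, `Z(n)^{β₁′+1} ∈ g(n)τ(i/2) + ℤτ(1)`; for any `n ≡ 6 (mod 16)`,
`Z(n)^{β₂′+1} ∈ g(n)τ(i/2) + ℤτ(1)`" — displayed for the divisors `d ≡ 6 (mod 8)` with `d ≡ n (mod 16)` ONLY
(then the package `β` is the printed `βⱼ′`; these are exactly the blocks `d₀ ≡ 6` occurring in Prop. 3.4 and in
the line p0020 L153, since their cofactor is `≡ 1 (mod 8)`; NOT displayed for `d ≢ n (mod 16)`, where print
pairs `d` with the other `βⱼ′`); "for any `n ≡ 7 (mod 8)`, `Z(n)^{β₁′+1} = Z(n)^{β₂′+1} = g(n)τ(1/2)`".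
[cite: TianYuanZhang2017, Lemma 3.21 (chunk p0020 L27–L45); choice of β (p0020 L107–L117)] -/
def lemma321 (D : GenusPointData n) : Prop :=
  ∀ d ∈ n.divisors,
    (d % 8 = 5 → ∃ m : ℤ, D.betaPt (D.Z d) + D.Z d = (gK d : ℤ) • D.tauHalfOneMinusI + m • tauOne) ∧
    (d % 8 = 6 → d % 16 = n % 16 →
      ∃ m : ℤ, D.betaPt (D.Z d) + D.Z d = (gK d : ℤ) • D.tauIHalf + m • tauOne) ∧
    (d % 8 = 7 → D.betaPt (D.Z d) + D.Z d = (gK d) • (tauHalf : APoint D.H))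

/-! ## §5 The ONE named fact: Tian–Yuan–Zhang §3 provides such data -/

/-- The conjunction of the displayed §3 statements for the data `D`. [cite: TianYuanZhang2017, §3 (Prop. 3.4, Thm. 3.5, Lemma 3.18, Lemma 3.21, proof of Thm. 3.5 (2))] -/
def Printed (D : GenusPointData n) : Prop :=
  D.scriptLSpec ∧ D.epsSpec ∧ D.recursion ∧ D.prop34 ∧ D.thm35Main ∧ D.thm35Bullet1 ∧ D.thm35Bullet2 ∧
    D.thm35Bullet2Ie ∧ D.lemma318 ∧ D.betaSpec ∧ D.lemma321

end GenusPointData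

/-- **Tian–Yuan–Zhang 2017, §3 (Prop. 3.4, Thm. 3.5 main clause and both bullets, Lemma 3.18, Lemma 3.21, and the
Galois facts of the proof of Thm. 3.5 (2)), AS PRINTED, as ONE named fact**: for every positive square-free
`n ≡ 5, 6, 7 (mod 8)` there are data `D : GenusPointData n` — the number field `ℍ′_n ∋ i, √−d (d ∣ n)`, Galois over
`ℚ`, an automorphism `β = β′|_{ℍ′_n}`, genus points `Z(d₀)`, points `P(d)`, sign choices of `𝓛(d)` and of
`ε(d₀, d₁)` — satisfying the displayed statements `GenusPointData.Printed`.  Constructed in the source from CM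
points on `X_U → A` (§3.1), the Gross–Zagier formula of Yuan–Zhang–Zhang (Thm. 3.3) and class field theory
(§3.2–3.3); no `_holds` expected.  W2 PHASE 0 DRAFT v3 — not proposed: second read of record filed
(p2-monsky-lit, 27/27 NO OBJECTION), referee rulings (α)(β)(γ) applied (`p2/REFEREE.md` l.317); p2-idea-2's
cross-read and the lead's W2 GO line precede any proposal (p2-lead L1-56 / L1-61 / L1-62).
[cite: TianYuanZhang2017, §3: Prop. 3.4 (p0011 L76–L89), Thm. 3.5 (p0011 L94–L112), Lemma 3.18 (p0017 L152–L153), Lemma 3.21 (p0020 L27–L45), proof of Thm. 3.5 (2) (p0020 L107–L122, L143–L148)] -/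
def tyz_genusPointData : Prop :=
  ∀ (n : ℕ), Squarefree n → (n % 8 = 5 ∨ n % 8 = 6 ∨ n % 8 = 7) →
    ∃ D : GenusPointData n, D.Printed

end Literature.NumberTheory.EllipticCurves.TianYuanZhang2017

end
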